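import Literature.MathematicalPhysics.QuantumFieldTheory.BalabanImbrieJaffe1984to88.BIJ88Eq596Density

/-!
# `BalabanImbrieJaffe1984to88.BIJ88Eq596Sectors` — T. Bałaban, J. Imbrie, A. Jaffe, *Effective action and cluster properties of the
abelian Higgs model*, Commun. Math. Phys. **114** (1988) 257–315 [BalabanImbrieJaffe1988], **(5.9.6)** p. 297 [PDF 41]: *"Let us summarize
the operations performed so far by using the concluding formulae in the last several sections to write a complete expression for our
density."* — **THE POINTWISE IDENTITY `h59` OF THE (5.9.6) FRAME, SLOT BY SLOT.**

statement-level skeleton of published theorems with citation tags; proofs where landed; nothing here is a claim about the Yang–Mills mass gap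

WHAT THIS FILE DOES (row `C2.Eq5.9.6` of `HOME/lit-balaban-r16/ROWS-C2-part2.md`, owner r16; its recorded flip condition: *"the ONE pointwise
identity `h59` rewriting the renamed bracket into the printed lines 2–8 … instantiated, slot by slot, by the tree's §§5.4–5.8 concluding
identities BY NAME"*).  The frame theorem of this seat's gen 9 (`BIJ88Eq596Density.eq596_printed`) derives the display (5.9.6) at measure
level from (5.2.8) and ONE pointwise hypothesis `h59 : bracket596 D = renamedBracket (…) read in the shifted gauge variable and the translated
scalar variable`, quantified over ALL values of the translated gauge field `u′`.  Two things are done here.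

* §1 **The frame needs `h59` only in the axial gauge** (`isDT_congr_bracket_ae`, `eq596_printed_ax`).  The concluding formulae of Sects. 5.3–5.5
  are identities in the logarithmic coordinates `u′_b = e^{ie_kA′_b}`, `f(p) = (ie_k)⁻¹ log v(p)` (p. 280: *"Using the restrictions
  |u(p) − 1| ≦ e_kp(e_k) in Λ₀^{(k)**}, and the axial gauge conditions, we obtain that u′_b = e^{ie_kA′_b} with |A′_b| ≦ cp(e_k)"*; (5.3.2)), so they
  hold on the tree-gauge configurations only; since the measure of (5.9.6) is `∫𝒟u δ_{Ax}(u)(·)` (r18's `axialMeasure`, supported on the axial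
  gauge: `ae_deltaAx_axialMeasure`) and the translation `u ↦ u′_Λ(u)` preserves the tree gauge (p31's `deltaAx_surfMul_iff`), the pointwise
  rewriting of the bracket is needed only for `u′` with `u′_b = 1` on the axial tree bonds (`DeltaAx u′`).
* §§2–4 **`h59` ⇐ the printed concluding formulae, one displayed identity per printed display, on the objects of record.**  The (5.2.8) bracket
  OF RECORD is `ζ_{Λ₀ᶜ}χ_{Λ₀} · ρ′_k · exp[−½aL⁻²⟨ψ − Q(u_k)φ, ψ − Q(u_k)φ⟩ − E^{(k)}]` with `ρ′_k` r18's (4.1) term density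
  `BIJ88InductiveForm41.rhoPrime (T t) ∘ cfg` = `χ_k Π_ωg_k(X_ω) Π_j[Z^{(j)}Z^{(j)}(u_k)] exp[−½⟨Λ₅′**f^{(k)}, σ_{k,loc}·⟩ − ½⟨Λ₈′φ, Δ_{k,loc}(u_k)Λ₈′φ⟩ −
  𝒫_{k,loc} − ℰ_k] Π_σF_{k,loc}(X_σ)` and the `ψ`-Gaussian r18's `gaussWeight` (gen 8's `BIJ88Eq528Density.density528`; here `rho528 w T`).  Read at the
  ORIGINAL variables expressed through the new ones — `u = (u′·s_t)·(Λ₁^{(k)′*}Q^{s*}v)` ((5.3.1) with the (5.5.2) shift `s_t`; `uOrig`),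
  `φ = λ⁻¹(φ^{(k)} + c_t)` ((5.4.5)⁻¹ after (5.8.1); `phiOrig`), `ψ = λ′⁻¹ψ` (`psiOrig`) — the renamed-shifted-translated bracket IS
  `rho528 · gaussWeight` at `(uOrig, phiOrig, psiOrig)` (`renamedBracket_shift_transl`, definitional), and `h59` FOLLOWS (`h59_of_sectors`) from:
  - **(G)** the gauge-field quadratic form, (5.3.5) p. 280 + (5.5.12) p. 285: *"To summarize the effect of the two translations, we have
    ½⟨Λ₅^{(k−1)′**}f^{(k)}, σ_{k,loc}Λ₅^{(k−1)′**}f^{(k)}⟩ = 𝒬₁ + 𝒬′₁ = 𝒬₁ + ½⟨Λ₁^{(k)**}∂A^{(k)}, σ_{k,loc}Λ₁^{(k)**}∂A^{(k)}⟩ + ½⟨Λ₅^{(k)′**}f,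
    σ^L_{k+1,loc}Λ₅^{(k)′**}f⟩ + 𝒬₂ + 𝒬₃ + ⟨f, w₃A^{(k)}⟩ + ½⟨f, w₄f⟩. (5.5.12)"* (hypothesis `hG`; the two printed steps `hG_of_steps`);
  - **(S)** the scalar quadratic forms, the `ψ`-Gaussian and the interaction, (5.4.5)–(5.4.6) p. 282 (the background gauge transformation,
    absorbed by the rotations `φ′ = λφ`, `ψ′ = λ′ψ`) + (5.6.13) p. 288 *"½aL⁻²⟨ψ̃ − Q(u′_k)φ̃, ψ̃ − Q(u′_k)φ̃⟩ + ½⟨Λ₈^{(k−1)′}φ̃, Δ_{k,loc}(u′_k)Λ₈^{(k−1)′}φ̃⟩ +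
    𝒫_{k,loc}(Λ₈^{(k−1)′}φ̃, u′_k) = ½aL⁻²⟨ψ − Q(ũ_{k+1})φ, ψ − Q(ũ_{k+1})φ⟩ + ½⟨Λ₈^{(k−1)′}φ, Δ_{k,loc}(ũ_{k+1})Λ₈^{(k−1)′}φ⟩ + 𝒫_{k,loc}(Λ₈^{(k−1)}, φ,
    ũ_{k+1}) + R^{(k)}(u_{k+1}, θ_kH_{k,loc}A^{(k)}) + Σ_□ W₁^{(k)}(□). (5.6.13)"* + (5.8.3) p. 296 *"To summarize, we have written ½⟨Λ₈^{(k−1)′}φ,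
    Δ_{k,loc}(ũ_{k+1})Λ₈^{(k−1)′}φ⟩ + ½aL⁻²⟨ψ − Q(ũ_{k+1})φ, ψ − Q(ũ_{k+1})φ⟩ = 𝒬₄ + 𝒬₅ + 𝒬₆ + ½⟨Λ₈^{(k−1)′}φ^{(k)}, (Δ_{k,loc}(ũ_{k+1}) +
    aL⁻²P(ũ_{k+1}))Λ₈^{(k−1)′}φ^{(k)}⟩ + ½⟨Λ₈^{(k)″}ψ, Δ^L_{k+1,loc}(u_{k+1})Λ₈^{(k)′}ψ⟩ + ⟨φ^{(k)}, w₆ψ⟩ + ½⟨ψ, w₇ψ⟩, (5.8.3)"* (hypothesis `hS`; the three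
    printed steps `hS_of_steps`);
  - **(Z)** the normalization factors, p. 283 *"We can gauge away the term ∂C_kΛ₃^{(k)*}A′"* + (5.7.13) p. 295 *"We can summarize the results
    of this section as follows: Π_{j=0}^{k−1}Z^{(j)}_{Λ₁₀^{(j)}}(u_{k+1}ũ̃) = Π_{j=0}^{k−1}Z^{(j)}_{Λ₁₀^{(j)}}(u_{k+1}) exp[−Q^{(k)}(u_{k+1}, θ_kH_{k,loc}A^{(k)}) −
    Σ_X W₂^{(k)}(X)], (5.7.13)"* (hypothesis `hZ`; the two printed steps `hZ_of_steps`);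
  - **(C)** the characteristic functions, p. 297: the insertions of `χ_{k+1,Λ₀^{(k)′}}`, `χ′_{Λ₇^{(k)}}` *"without changing anything"* / *"and the
    integral is unchanged"* and the replacement of `χ_{k,Λ₀^{(k−1)′}}` by `χ_{k,Λ₀^{(k−1)′}∩Λ₁^{(k)c}}` *"without changing anything"* — read as:
    the (5.9.6) entry `chars` is `ζχ·χ_k` times an inserted factor equal to `1` wherever `ζχ·χ_k ≠ 0` (hypotheses `hchars`, `hins`);
  - the entries `Π_ωg_k(X_ω)`, `Π_σ(F^{(m̄)} + F̃)` ((5.6.14): a split of `F_{k,loc}`), `ℰ_k`, `E^{(k)}` are the same objects read at the original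
    variables (hypotheses `hholes`, `hobs`, `hcalE`, `hEk` — identically true for the filled table `fill41`, §4).
  Then `eq596_of_sectors` = (5.9.6) at measure level with exactly these displayed identities as hypotheses, and `eq596_of_sectors_filled`
  with only `hins`, `hG`, `hS`, `hZ` left (each the content of its own row: C2.Eq5.3.1-5.3.7/C2.Eq5.5.1-5.5.12, C2.Eq5.4.1-5.4.6/
  C2.Eq5.6.13/C2.Eq5.8.1-5.8.3, C2.Eq5.7.13, C2.Eq5.9.1-5.9.5; the identities are to be fed BY NAME by those rows' torus theorems — e.g.
  p31's `BIJ88DeltaLoc234Torus.form_deltaLocT_gaugeAct` is the rotation step of (S) for the concrete `Δ_{k,loc}`).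
* §5 the input display (5.2.8) for this bracket of record IS gen 8's `BIJ88Eq528Density.density528` / `density528_rt51_printed` (by name,
  definitionally: `isRD_rho528`, `isRD_rho528_rt51`), so the chain (5.1.1) → (5.2.8) → (5.9.6) is connected on one integrand.

HONEST SCOPE.  Nothing here proves (G), (S), (Z) or the support claim of (C): they are DISPLAYED hypotheses in the printed shapes, on r18's
abstract `Term41` slots (`σloc`, `Δloc`, `Ploc`, `Zs`, `uk`, …) and the transcribed `Bracket596` slots; no bound; nothing of §§5.10–5.15.
Pages re-read for this file as images: p. 280 [PDF 24], pp. 283–288 [PDF 27–32], pp. 293–297 [PDF 37–41] (this seat's renders +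
r16's `HOME/lit-balaban-r16/renders/cmp114/`).  Definitions with bodies (`uOrig`, `phiOrig`, `psiOrig`, `rho528`, `gaussQuad`, `fill41`) and
theorems; 0 `sorry`; NO `Prop`-valued fact; imports this seat's `BIJ88Eq596Density` only (Literature + Mathlib); standard axioms.
Seat p34 gen 13 (unit `lit-balaban-p34-g13`; TAKING line HOME/STATUS.md 2026-08-22T12:11:44Z; own lineage = the measure-level density line
(5.2.8) → (5.9.6) → (5.12.8)).
-/

namespace Literature.MathematicalPhysics.QuantumFieldTheory.BalabanImbrieJaffe1984to88.BIJ88Eq596Sectors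

open Literature.MathematicalPhysics.QuantumFieldTheory.Balaban1983to89
open BIJ88Sect3Statements (U1 cfg E0step)
open BIJ85Sect1Model (HiggsField)
open BIJ85RT33 (twist)
open BIJ88BlockGauge417 (twist_inv_twist)
open BIJ88RenormTransf311 (axialMeasure axialBonds gaussWeight DeltaAx ae_deltaAx_axialMeasure)
open BIJ88InductiveForm41 (Prev prevMeasure Term41 rhoPrime gaugeForm scalarForm)
open BIJ85BlockAveragesTorus (qU surfMul)
open BIJ88Eq536Linearization (cutoff deltaAx_surfMul_iff)
open BIJ88RT52Restrictions (Fields fieldsMeasure IsRD)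
open BIJ88Eq596Display (uCut vCut IsDT uCut_def)
open BIJ88RT54ScalarSubst (isDT_translatePhi)
open BIJ88RT552Transl (bondMul isDT_bondShift_axial)
open BIJ88Eq596Frame (Entry Bracket596 exponent596 bracket596 integral_renamed_eq)
open BIJ88Eq596Density (rho596 isDT_rho596 renamedBracket renamedBracket_twist integrable_renamedBracket)
open scoped BigOperators ENNReal
open _root_.MeasureTheory _root_.MeasureTheory.Measure Complex Function

noncomputable section

variable {P : Params} {k : ℕ}

/-! ## §1 The frame needs `h59` only on the axial gauge -/

section Frame

variable {ι : Type*} {ν : Measure (GaugeField P k U1)} {terms : Finset ι} {Λ : ι → Finset (PBond P (k+1))}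
variable {Qu : GaugeField P k U1 → GaugeField P (k+1) U1}
variable {J J' : ι → Prev P k → GaugeField P k U1 → GaugeField P (k+1) U1 → HiggsField P k → HiggsField P (k+1) → ℂ}
variable {ρL : GaugeField P (k+1) U1 → HiggsField P (k+1) → ℂ}

/-- **Rewriting the bracket of line 1 of (5.9.6) `ν`-ALMOST EVERYWHERE does not change the display**: if for every term and for `ν`-a.e.
gauge field `u` the brackets `J′_t` and `J_t` agree at the translated configurations `(u′_Λ(u), v_Λ(u, v′))` for all `{u^{(j)}}, v′, φ, ψ`,
then a density of the display with `J` is a density of the display with `J′` (the *"concluding formulae in the last several sections"*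
hold on the support of `∫𝒟u δ_{Ax}(u)(·)` — the axial gauge — not everywhere). [cite: BalabanImbrieJaffe1988, (5.9.6) p.297] -/
theorem isDT_congr_bracket_ae (h : IsDT ν terms Λ Qu J ρL)
    (hJ : ∀ t ∈ terms, ∀ᵐ U ∂ν, ∀ prev v' φ ψ,
      J' t prev (uCut Qu (Λ t) U) (vCut Qu (Λ t) U v') φ ψ = J t prev (uCut Qu (Λ t) U) (vCut Qu (Λ t) U v') φ ψ) :
    IsDT ν terms Λ Qu J' ρL := fun g hg hb => by
  rw [h g hg hb]
  refine Finset.sum_congr rfl fun t ht => ?_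
  refine integral_congr_ae (Filter.Eventually.of_forall fun v' => ?_)
  refine integral_congr_ae ((hJ t ht).mono fun U hU => ?_)
  simp only [hU]

/-- kernel: the translated variable `u′_Λ(u)` of an axial-gauge configuration is in the axial gauge (p31's `deltaAx_surfMul_iff`: the
surface bonds carrying `Q^{s*}` are not tree bonds). [cite: BalabanImbrieJaffe1988, (5.3.6) p.280] -/
theorem deltaAx_uCut {U : GaugeField P k U1} (hU : DeltaAx U) (Λ₀ : Finset (PBond P (k+1))) : DeltaAx (uCut qU Λ₀ U) := by
  rw [uCut_def]
  exact (deltaAx_surfMul_iff _ _).2 hU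

variable {Qφ : ι → Prev P k → GaugeField P k U1 → HiggsField P k → HiggsField P (k+1)} {a : ℝ}
variable {ρ : ι → Prev P k → GaugeField P k U1 → HiggsField P k → HiggsField P (k+1) → ℂ}

/-- **(5.9.6) WITH THE TRANSCRIBED BRACKET — `h59` REQUIRED IN THE AXIAL GAUGE ONLY.**  This seat's `BIJ88Eq596Density.eq596_printed` with its
last hypothesis weakened: the pointwise identity between the printed bracket `bracket596 D` and the renamed bracket read in the shifted and
translated variables is assumed only for translated gauge fields `u′` in the axial gauge (`u′_b = 1` on the tree bonds of [2] (3.4)), which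
is where the integrand of `∫du^{(k)} δ_{Ax}(u^{(k)}) …` lives (`ae_deltaAx_axialMeasure`, `deltaAx_uCut`).  Same conclusion: the renamed
density `ρ^L_{k+1} = rho596 …` satisfies line 1 of (5.9.6) with lines 2–8 as the bracket, and `∫dvdψ ρ^L_{k+1} = ∫dvdψ ρ̃^L_{k+1}`.
[cite: BalabanImbrieJaffe1988, (5.9.6) p.297] -/
theorem eq596_printed_ax (D : Bracket596 P k ι) (hk : k + 1 ≤ P.m + P.K) (h528 : IsRD (axialMeasure P k U1) terms qU Qφ a ρ ρL)
    (hρi : ∀ t ∈ terms, Integrable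
      (fun q : Fields P k => ρ t q.2.1 q.1 q.2.2.1 q.2.2.2 * (gaussWeight a (Qφ t q.2.1 q.1 q.2.2.1) q.2.2.2 : ℂ))
      (fieldsMeasure (axialMeasure P k U1)))
    (Λ : ι → Finset (PBond P (k+1)))
    (lamφ : ι → Prev P k → GaugeField P k U1 → GaugeField P (k+1) U1 → GaugeTransf P k U1)
    (lamψ : ι → Prev P k → GaugeField P k U1 → GaugeField P (k+1) U1 → GaugeTransf P (k+1) U1)
    (hmφ : ∀ t ∈ terms, Measurable fun x : GaugeField P k U1 × Prev P k => lamφ t x.2 (uCut qU (Λ t) x.1) (qU x.1))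
    (hmψ : ∀ t ∈ terms, Measurable fun x : GaugeField P k U1 × Prev P k => lamψ t x.2 (uCut qU (Λ t) x.1) (qU x.1))
    (s : ι → GaugeField P (k+1) U1 → GaugeField P k U1) (hs : ∀ t ∈ terms, ∀ w, ∀ b ∈ (axialBonds : Finset (PBond P k)), s t w b = 1)
    (S : ι → Set (GaugeField P k U1))
    (hsupp : ∀ t ∈ terms, ∀ prev u' v φ ψ, renamedBracket Qφ a ρ Λ lamφ lamψ t prev u' v φ ψ ≠ 0 → u' ∈ S t)
    (hQS : ∀ t ∈ terms, ∀ u' ∈ S t, ∀ w, qU (bondMul u' (s t w)) = qU u' ∧ qU (bondMul u' fun b => (s t w b)⁻¹) = qU u')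
    (c : ι → Prev P k → GaugeField P k U1 → GaugeField P (k+1) U1 → HiggsField P (k+1) → HiggsField P k)
    (h59 : ∀ t ∈ terms, ∀ prev u' v φ ψ, DeltaAx u' → bracket596 D t prev u' v φ ψ =
      renamedBracket Qφ a ρ Λ lamφ lamψ t prev (bondMul u' (s t (cutoff (Λ t) v))) v (φ + c t prev u' v ψ) ψ) :
    IsDT (axialMeasure P k U1) terms Λ qU (bracket596 D) (rho596 terms Λ (renamedBracket Qφ a ρ Λ lamφ lamψ)) ∧
      ∫ v, ∫ ψ, rho596 terms Λ (renamedBracket Qφ a ρ Λ lamφ lamψ) v ψ ∂volume ∂fieldMeasure P (k+1) U1 =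
        ∫ v, ∫ ψ, ρL v ψ ∂volume ∂fieldMeasure P (k+1) U1 := by
  have hJ₂ : ∀ t ∈ terms, Integrable
      (fun q : Fields P k => renamedBracket Qφ a ρ Λ lamφ lamψ t q.2.1 (uCut qU (Λ t) q.1) (qU q.1) q.2.2.1 q.2.2.2)
      (fieldsMeasure (axialMeasure P k U1)) :=
    fun t ht => integrable_renamedBracket Qφ a ρ Λ lamφ lamψ t (hρi t ht) (hmφ t ht) (hmψ t ht)
  have h₂ := isDT_rho596 hk hJ₂
  refine ⟨?_, integral_renamed_eq hk h528 hρi lamφ lamψ (renamedBracket_twist Qφ a ρ Λ lamφ lamψ) h₂⟩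
  have h5 := isDT_translatePhi c (isDT_bondShift_axial hk s hs S hsupp hQS h₂)
  refine isDT_congr_bracket_ae h5 fun t ht => ?_
  refine (ae_deltaAx_axialMeasure (P := P) (j := k) (G := U1)).mono fun U hU prev v' φ ψ => ?_
  exact h59 t ht prev _ _ φ ψ (deltaAx_uCut hU (Λ t))

end Frame

/-! ## §2 The original variables in terms of the new ones, and the (5.2.8) bracket of record -/

section Orig

variable {ι : Type*}

/-- **The original unit-lattice gauge field `u` of (5.2.8) in terms of the new variables** — (5.3.1) *"u = u′(Λ₁^{(k)*}Q^{s*}v)"* composed with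
the (5.5.2) shift in multiplicative form, `u′ = u^{(k)}·s_t(v|_Λ)` (this seat's `BIJ88RT552Transl.bondMul`): `u = (u^{(k)}·s_t(cutoff_{Λ_t}v))·
Q^{s*}(cutoff_{Λ_t}v)`. [cite: BalabanImbrieJaffe1988, (5.3.1) p.280] -/
def uOrig (Λ : ι → Finset (PBond P (k+1))) (s : ι → GaugeField P (k+1) U1 → GaugeField P k U1) (t : ι)
    (u' : GaugeField P k U1) (v : GaugeField P (k+1) U1) : GaugeField P k U1 :=
  surfMul (bondMul u' (s t (cutoff (Λ t) v))) (cutoff (Λ t) v)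

/-- **The original scalar field `φ` in terms of the new variables** — the p. 282 rotation undone, *"φ′(x) = φ(x)e^{ie_k(Λ₁^{(k)}C_{k,loc}A′)(x)}"*,
after the (5.8.1) translation *"φ = φ^{(k)} + aL⁻²Λ₇^{(k)}C^{(k)}_{loc}(u_{k+1})Q*(u_{k+1})ψ"*: `φ = λ⁻¹(φ^{(k)} + c_t)` (the phase `λ = lamφ`
evaluated, as in this seat's `renamedBracket`, at the shifted gauge variable). [cite: BalabanImbrieJaffe1988, (5.8.1) p.295] -/
def phiOrig (Λ : ι → Finset (PBond P (k+1))) (s : ι → GaugeField P (k+1) U1 → GaugeField P k U1)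
    (lamφ : ι → Prev P k → GaugeField P k U1 → GaugeField P (k+1) U1 → GaugeTransf P k U1)
    (c : ι → Prev P k → GaugeField P k U1 → GaugeField P (k+1) U1 → HiggsField P (k+1) → HiggsField P k)
    (t : ι) (prev : Prev P k) (u' : GaugeField P k U1) (v : GaugeField P (k+1) U1) (φ : HiggsField P k) (ψ : HiggsField P (k+1)) :
    HiggsField P k :=
  twist (fun x => (lamφ t prev (bondMul u' (s t (cutoff (Λ t) v))) v x)⁻¹) (φ + c t prev u' v ψ)

/-- **The original block scalar field `ψ` in terms of the renamed one** — *"ψ′(y) = ψ(y)e^{ie_k(Λ₁^{(k)}C_{k,loc}A′)(y)}"* and *"a different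
density is obtained by replacing ψ′ with ψ"* (p. 282): `ψ_old = λ′⁻¹ψ`. [cite: BalabanImbrieJaffe1988, (5.4.6) p.282] -/
def psiOrig (Λ : ι → Finset (PBond P (k+1))) (s : ι → GaugeField P (k+1) U1 → GaugeField P k U1)
    (lamψ : ι → Prev P k → GaugeField P k U1 → GaugeField P (k+1) U1 → GaugeTransf P (k+1) U1)
    (t : ι) (prev : Prev P k) (u' : GaugeField P k U1) (v : GaugeField P (k+1) U1) (ψ : HiggsField P (k+1)) : HiggsField P (k+1) :=
  twist (fun y => (lamψ t prev (bondMul u' (s t (cutoff (Λ t) v))) v y)⁻¹) ψ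

/-- **The (5.2.8) bracket OF RECORD**: `ζ_{Λ₀^{(k)c}}χ_{Λ₀^{(k)}}` (a real weight `w_t` on the configurations — gen 8's `weight527` of the printed
`χ_x, χ_y, χ_b, χ_p`) times r18's (4.1) term density `ρ′_k = χ_k Πg_k ΠF_{k,loc} Π[ZZ(u_k)] exp[−½⟨f,σf⟩ − ½⟨φ,Δφ⟩ − 𝒫 − ℰ_k]`
(`BIJ88InductiveForm41.rhoPrime`) read through `cfg` — the integrand of gen 8's `BIJ88Eq528Density.density528`.
[cite: BalabanImbrieJaffe1988, (5.2.8) p.279] -/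
def rho528 (w : ι → Prev P k → GaugeField P k U1 → HiggsField P k → HiggsField P (k+1) → ℝ) (T : ι → Term41 P k) :
    ι → Prev P k → GaugeField P k U1 → HiggsField P k → HiggsField P (k+1) → ℂ :=
  fun t prev U φ ψ => (w t prev U φ ψ : ℂ) * rhoPrime (T t) prev (cfg U) φ

/-- **`½aL⁻²⟨ψ − Q(u_k)φ, ψ − Q(u_k)φ⟩`** — the exponent of r18's `gaussWeight` without the constant `E^{(k)}` (`⟨f, g⟩ = Σ_y L^d f̄(y)g(y)` the
`L`-lattice inner product, centre `Q(u_k)φ`). [cite: BalabanImbrieJaffe1988, (5.2.8) p.279] -/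
def gaussQuad (a : ℝ) (cφ ψ : HiggsField P (k+1)) : ℝ :=
  (1 / 2 : ℝ) * (a * (P.L : ℝ)⁻¹ ^ 2) * ∑ y, (P.L : ℝ) ^ P.d * ‖ψ y - cφ y‖ ^ 2

/-- kernel: `gaussWeight = exp[−½aL⁻²⟨ψ − Qφ, ψ − Qφ⟩ − E^{(k)}]` in the named pieces. [cite: BalabanImbrieJaffe1988, (5.2.8) p.279] -/
theorem gaussWeight_eq_exp (a : ℝ) (cφ ψ : HiggsField P (k+1)) :
    gaussWeight (P := P) (j := k) a cφ ψ =
      Real.exp (-(gaussQuad a cφ ψ + E0step (Fintype.card (Balaban1983to89.Site P (k+1))) a P.L P.d)) := by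
  unfold gaussWeight gaussQuad
  congr 1
  ring

/-- **The renamed bracket, read in the shifted gauge variable and the translated scalar variable, IS the (5.2.8) bracket at the original
variables** (definitional): `renamedBracket (…) (u^{(k)}·s_t, v, φ^{(k)} + c_t, ψ) = ρ_t(uOrig, phiOrig, psiOrig) · gaussWeight(Q_t(uOrig) phiOrig, psiOrig)`.
[cite: BalabanImbrieJaffe1988, (5.9.6) p.297] -/
theorem renamedBracket_shift_transl (Qφ : ι → Prev P k → GaugeField P k U1 → HiggsField P k → HiggsField P (k+1)) (a : ℝ)
    (ρ : ι → Prev P k → GaugeField P k U1 → HiggsField P k → HiggsField P (k+1) → ℂ) (Λ : ι → Finset (PBond P (k+1)))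
    (lamφ : ι → Prev P k → GaugeField P k U1 → GaugeField P (k+1) U1 → GaugeTransf P k U1)
    (lamψ : ι → Prev P k → GaugeField P k U1 → GaugeField P (k+1) U1 → GaugeTransf P (k+1) U1)
    (s : ι → GaugeField P (k+1) U1 → GaugeField P k U1)
    (c : ι → Prev P k → GaugeField P k U1 → GaugeField P (k+1) U1 → HiggsField P (k+1) → HiggsField P k)
    (t : ι) (prev : Prev P k) (u' : GaugeField P k U1) (v : GaugeField P (k+1) U1) (φ : HiggsField P k) (ψ : HiggsField P (k+1)) :
    renamedBracket Qφ a ρ Λ lamφ lamψ t prev (bondMul u' (s t (cutoff (Λ t) v))) v (φ + c t prev u' v ψ) ψ =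
      ρ t prev (uOrig Λ s t u' v) (phiOrig Λ s lamφ c t prev u' v φ ψ) (psiOrig Λ s lamψ t prev u' v ψ) *
        (gaussWeight a (Qφ t prev (uOrig Λ s t u' v) (phiOrig Λ s lamφ c t prev u' v φ ψ)) (psiOrig Λ s lamψ t prev u' v ψ) : ℂ) :=
  rfl

end Orig

/-! ## §3 `h59` from the concluding formulae, sector by sector -/

section Sectors

variable {ι : Type*} {terms : Finset ι}

/-- kernel: splitting one exponential into three. [cite: BalabanImbrieJaffe1988, (5.9.6) p.297] -/
private theorem exp_eq_three {e x y z : ℝ} (h : e = x + y + z) : Real.exp e = Real.exp x * Real.exp y * Real.exp z := by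
  subst h
  rw [Real.exp_add, Real.exp_add]

/-- **`h59` SLOT BY SLOT.**  For the (5.2.8) bracket of record `rho528 w T` (weight `ζχ`, r18's `rhoPrime (T t) ∘ cfg`) and the `ψ`-Gaussian
`gaussWeight a (Q_t φ) ψ`, the pointwise identity `h59` of `eq596_printed_ax` — *the printed bracket of (5.9.6), lines 2–8, equals the renamed
bracket read in the shifted gauge variable and the translated scalar variable*, on the axial gauge — FOLLOWS from the concluding formulae of
Sects. 5.3–5.9 stated as identities between r18's (4.1) slots read at the original variables `(u, φ, ψ) = (uOrig, phiOrig, psiOrig)` and the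
transcribed entries `D` of (5.9.6): `hchars`/`hins` (Sect. 5.9 p. 297: the entry `ζχχ_{k,…∩Λ₁ᶜ}χ_{k+1}χ′` is `ζχ·χ_k` times inserted
factors equal to `1` on the support of `ζχ·χ_k` — *"without changing anything"*), `hholes` (`Π_ωg_k(X_ω)` unchanged), `hobs` (`Π_σF_{k,loc} =
Π_σ(F^{(m̄)} + F̃)`, (5.6.14)), `hZ` ((5.7.13) with the gauge invariance of the `Z^{(j)}(u_k)`: `Π_j[Z^{(j)}Z^{(j)}(u_k)] = Π_j[Z^{(j)}Z^{(j)}(u_{k+1})]·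
e^{−Q^{(k)}−Σ_XW₂}`), `hG` ((5.3.5)+(5.5.12): `½⟨Λ₅′**f^{(k)}, σ_{k,loc}Λ₅′**f^{(k)}⟩ = 𝒬₁ + ½⟨Λ₁**∂A, σ∂A⟩ + ½⟨Λ₅′**f, σ^Lf⟩ + 𝒬₂ + 𝒬₃ + ⟨f,w₃A⟩ +
½⟨f,w₄f⟩`), `hS` ((5.4.6)+(5.6.13)+(5.8.3): `½aL⁻²|ψ − Q(u_k)φ|² + ½⟨Λ₈′φ, Δ_{k,loc}(u_k)Λ₈′φ⟩ + 𝒫_{k,loc} = 𝒬₄ + 𝒬₅ + 𝒬₆ + ½⟨Λ₈′φ^{(k)},(Δ +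
aL⁻²P)Λ₈′φ^{(k)}⟩ + ½⟨Λ₈′ψ, Δ^LΛ₈′ψ⟩ + ⟨φ^{(k)},w₆ψ⟩ + ½⟨ψ,w₇ψ⟩ + 𝒫_{k,loc}(Λ₈, ũ_{k+1}) + R^{(k)} + Σ_□W₁`), `hcalE` (`ℰ_k`), `hEk` (`E^{(k)}` = r18's
`E0step` on the `L`-lattice). [cite: BalabanImbrieJaffe1988, (5.9.6) p.297] -/
theorem h59_of_sectors (D : Bracket596 P k ι) (T : ι → Term41 P k)
    (w : ι → Prev P k → GaugeField P k U1 → HiggsField P k → HiggsField P (k+1) → ℝ) (a : ℝ)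
    (Qφ : ι → Prev P k → GaugeField P k U1 → HiggsField P k → HiggsField P (k+1))
    (Λ : ι → Finset (PBond P (k+1))) (s : ι → GaugeField P (k+1) U1 → GaugeField P k U1)
    (lamφ : ι → Prev P k → GaugeField P k U1 → GaugeField P (k+1) U1 → GaugeTransf P k U1)
    (lamψ : ι → Prev P k → GaugeField P k U1 → GaugeField P (k+1) U1 → GaugeTransf P (k+1) U1)
    (c : ι → Prev P k → GaugeField P k U1 → GaugeField P (k+1) U1 → HiggsField P (k+1) → HiggsField P k)
    (χins : Entry P k ι ℝ)
    (hchars : ∀ t ∈ terms, ∀ prev u' v φ ψ, DeltaAx u' → D.chars t prev u' v φ ψ =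
      w t prev (uOrig Λ s t u' v) (phiOrig Λ s lamφ c t prev u' v φ ψ) (psiOrig Λ s lamψ t prev u' v ψ) *
        (T t).chi prev (cfg (uOrig Λ s t u' v)) (phiOrig Λ s lamφ c t prev u' v φ ψ) * χins t prev u' v φ ψ)
    (hins : ∀ t ∈ terms, ∀ prev u' v φ ψ, DeltaAx u' →
      w t prev (uOrig Λ s t u' v) (phiOrig Λ s lamφ c t prev u' v φ ψ) (psiOrig Λ s lamψ t prev u' v ψ) *
        (T t).chi prev (cfg (uOrig Λ s t u' v)) (phiOrig Λ s lamφ c t prev u' v φ ψ) ≠ 0 → χins t prev u' v φ ψ = 1)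
    (hholes : ∀ t ∈ terms, ∀ prev u' v φ ψ, DeltaAx u' → D.holes t prev u' v φ ψ =
      ((∏ ω, (T t).g ω prev (cfg (uOrig Λ s t u' v)) (phiOrig Λ s lamφ c t prev u' v φ ψ) : ℝ) : ℂ))
    (hobs : ∀ t ∈ terms, ∀ prev u' v φ ψ, DeltaAx u' → D.obs t prev u' v φ ψ =
      ∏ σ, (T t).Floc σ prev (cfg (uOrig Λ s t u' v)) (phiOrig Λ s lamφ c t prev u' v φ ψ))
    (hZ : ∀ t ∈ terms, ∀ prev u' v φ ψ, DeltaAx u' →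
      (∏ j, (T t).Zv j * (T t).Zs j ((T t).uk prev (cfg (uOrig Λ s t u' v)))) =
        D.zf t prev u' v φ ψ * Real.exp (-(D.Qk t prev u' v φ ψ + D.W2 t prev u' v φ ψ)))
    (hG : ∀ t ∈ terms, ∀ prev u' v φ ψ, DeltaAx u' →
      (1 / 2 : ℝ) * gaugeForm (T t) (cfg (uOrig Λ s t u' v)) =
        D.Q1 t prev u' v φ ψ + D.quadA t prev u' v φ ψ / 2 + D.quadF t prev u' v φ ψ / 2 + D.Q2 t prev u' v φ ψ + D.Q3 t prev u' v φ ψ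
          + D.fw3A t prev u' v φ ψ + D.fw4f t prev u' v φ ψ / 2)
    (hS : ∀ t ∈ terms, ∀ prev u' v φ ψ, DeltaAx u' →
      gaussQuad a (Qφ t prev (uOrig Λ s t u' v) (phiOrig Λ s lamφ c t prev u' v φ ψ)) (psiOrig Λ s lamψ t prev u' v ψ)
        + (1 / 2 : ℝ) * scalarForm (T t) ((T t).uk prev (cfg (uOrig Λ s t u' v))) (phiOrig Λ s lamφ c t prev u' v φ ψ)
        + (T t).Ploc prev (cfg (uOrig Λ s t u' v)) (phiOrig Λ s lamφ c t prev u' v φ ψ) =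
        D.Q4 t prev u' v φ ψ + D.Q5 t prev u' v φ ψ + D.Q6 t prev u' v φ ψ + D.quadPhi t prev u' v φ ψ / 2
          + D.quadPsi t prev u' v φ ψ / 2 + D.phiW6Psi t prev u' v φ ψ + D.psiW7Psi t prev u' v φ ψ / 2
          + D.Pkloc t prev u' v φ ψ + D.Rk t prev u' v φ ψ + D.W1 t prev u' v φ ψ)
    (hcalE : ∀ t ∈ terms, ∀ prev u' v φ ψ, D.calE t prev u' v φ ψ = (T t).calE)
    (hEk : ∀ t ∈ terms, ∀ prev u' v φ ψ, D.Ek t prev u' v φ ψ = E0step (Fintype.card (Balaban1983to89.Site P (k+1))) a P.L P.d) :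
    ∀ t ∈ terms, ∀ prev u' v φ ψ, DeltaAx u' → bracket596 D t prev u' v φ ψ =
      renamedBracket Qφ a (rho528 w T) Λ lamφ lamψ t prev (bondMul u' (s t (cutoff (Λ t) v))) v (φ + c t prev u' v ψ) ψ := by
  intro t ht prev u' v φ ψ hax
  rw [renamedBracket_shift_transl, gaussWeight_eq_exp]
  -- names for the original variables and the slot values
  set U₀ := uOrig Λ s t u' v with hU₀
  set φ₀ := phiOrig Λ s lamφ c t prev u' v φ ψ with hφ₀
  set ψ₀ := psiOrig Λ s lamψ t prev u' v ψ with hψ₀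
  simp only [rho528, rhoPrime]
  by_cases h0 : w t prev U₀ φ₀ ψ₀ * (T t).chi prev (cfg U₀) φ₀ = 0
  · -- both sides vanish with `ζχ·χ_k`
    have hL : (D.chars t prev u' v φ ψ : ℂ) = 0 := by
      rw [hchars t ht prev u' v φ ψ hax, h0, zero_mul, Complex.ofReal_zero]
    have hR : (w t prev U₀ φ₀ ψ₀ : ℂ) * ((T t).chi prev (cfg U₀) φ₀ : ℂ) = 0 := by exact_mod_cast h0
    rw [bracket596, hL]
    simp only [zero_mul]
    symm
    calc _ = (w t prev U₀ φ₀ ψ₀ : ℂ) * ((T t).chi prev (cfg U₀) φ₀ : ℂ) *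
          (((∏ ω, (T t).g ω prev (cfg U₀) φ₀ : ℝ) : ℂ) * ((∏ j, (T t).Zv j * (T t).Zs j ((T t).uk prev (cfg U₀)) : ℝ) : ℂ) *
            (Real.exp (-(1 / 2 : ℝ) * gaugeForm (T t) (cfg U₀) - (1 / 2 : ℝ) * scalarForm (T t) ((T t).uk prev (cfg U₀)) φ₀
              - (T t).Ploc prev (cfg U₀) φ₀ - (T t).calE) : ℂ) * (∏ σ, (T t).Floc σ prev (cfg U₀) φ₀) *
            (Real.exp (-(gaussQuad a (Qφ t prev U₀ φ₀) ψ₀ + E0step (Fintype.card (Balaban1983to89.Site P (k+1))) a P.L P.d)) : ℂ)) := by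
          push_cast; ring
      _ = 0 := by rw [hR, zero_mul]
  · -- the inserted characteristic functions are `1` here
    have h1 := hins t ht prev u' v φ ψ hax h0
    -- the exponent of (5.9.6) is the sum of the three printed exponents
    have hexp : exponent596 D t prev u' v φ ψ =
        (-(1 / 2 : ℝ) * gaugeForm (T t) (cfg U₀) - (1 / 2 : ℝ) * scalarForm (T t) ((T t).uk prev (cfg U₀)) φ₀
          - (T t).Ploc prev (cfg U₀) φ₀ - (T t).calE)
        + (-(gaussQuad a (Qφ t prev U₀ φ₀) ψ₀ + E0step (Fintype.card (Balaban1983to89.Site P (k+1))) a P.L P.d))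
        + (-(D.Qk t prev u' v φ ψ + D.W2 t prev u' v φ ψ)) := by
      have eG := hG t ht prev u' v φ ψ hax
      have eS := hS t ht prev u' v φ ψ hax
      have eE := hcalE t ht prev u' v φ ψ
      have eK := hEk t ht prev u' v φ ψ
      simp only [exponent596]
      linarith
    rw [bracket596, exp_eq_three hexp, hchars t ht prev u' v φ ψ hax, h1, mul_one, hholes t ht prev u' v φ ψ hax,
      hobs t ht prev u' v φ ψ hax, hZ t ht prev u' v φ ψ hax]
    push_cast
    ring

/-- **(G) in its two printed steps** — (5.3.5) p. 280: *"The quadratic form f^{(k)} transforms into ½⟨Λ₅^{(k−1)′**}f^{(k)}, σ_{k,loc}Λ₅^{(k−1)′**}f^{(k)}⟩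
= … = 𝒬₁ + 𝒬′₁"*, then (5.5.12) p. 285: *"𝒬₁ + 𝒬′₁ = 𝒬₁ + ½⟨Λ₁^{(k)**}∂A^{(k)}, σ_{k,loc}Λ₁^{(k)**}∂A^{(k)}⟩ + ½⟨Λ₅^{(k)′**}f, σ^L_{k+1,loc}Λ₅^{(k)′**}f⟩
+ 𝒬₂ + 𝒬₃ + ⟨f, w₃A^{(k)}⟩ + ½⟨f, w₄f⟩"* (`Q1'` = `𝒬′₁`): the two displayed identities give hypothesis `hG` of `h59_of_sectors`.
[cite: BalabanImbrieJaffe1988, (5.5.12) p.285] -/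
theorem hG_of_steps (D : Bracket596 P k ι) (T : ι → Term41 P k)
    (Λ : ι → Finset (PBond P (k+1))) (s : ι → GaugeField P (k+1) U1 → GaugeField P k U1) (Q1' : Entry P k ι ℝ)
    (h535 : ∀ t ∈ terms, ∀ prev u' v φ ψ, DeltaAx u' →
      (1 / 2 : ℝ) * gaugeForm (T t) (cfg (uOrig Λ s t u' v)) = D.Q1 t prev u' v φ ψ + Q1' t prev u' v φ ψ)
    (h5512 : ∀ t ∈ terms, ∀ prev u' v φ ψ, DeltaAx u' → Q1' t prev u' v φ ψ =
      D.quadA t prev u' v φ ψ / 2 + D.quadF t prev u' v φ ψ / 2 + D.Q2 t prev u' v φ ψ + D.Q3 t prev u' v φ ψ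
        + D.fw3A t prev u' v φ ψ + D.fw4f t prev u' v φ ψ / 2) :
    ∀ t ∈ terms, ∀ prev u' v φ ψ, DeltaAx u' →
      (1 / 2 : ℝ) * gaugeForm (T t) (cfg (uOrig Λ s t u' v)) =
        D.Q1 t prev u' v φ ψ + D.quadA t prev u' v φ ψ / 2 + D.quadF t prev u' v φ ψ / 2 + D.Q2 t prev u' v φ ψ + D.Q3 t prev u' v φ ψ
          + D.fw3A t prev u' v φ ψ + D.fw4f t prev u' v φ ψ / 2 := by
  intro t ht prev u' v φ ψ hax
  rw [h535 t ht prev u' v φ ψ hax, h5512 t ht prev u' v φ ψ hax]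
  ring

/-- **(S) in its three printed steps** — (5.4.5)–(5.4.6) p. 282 (the background gauge transformation `u_k ↦ u′_k` with the rotations
`φ′ = λφ`, `ψ′ = λ′ψ` absorbing its phases: the three *"original expressions"* `⟨ψ − Q(u_k)φ, ψ − Q(u_k)φ⟩`, `⟨Λ₈′φ, Δ_{k,loc}(u_k)Λ₈′φ⟩`,
`𝒫_{k,loc}(Λ₈)` (p. 287) read at the old variables equal the same expressions at `(u′_k, φ̃, ψ̃)` — entry `mid1`), (5.6.13) p. 288 (`mid1 =
½aL⁻²|ψ − Q(ũ_{k+1})φ|² + ½⟨Λ₈′φ, Δ_{k,loc}(ũ_{k+1})Λ₈′φ⟩ + 𝒫_{k,loc}(Λ₈, φ, ũ_{k+1}) + R^{(k)} + Σ_□W₁`; the first two terms = entry `mid2`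
after (5.8.1)), (5.8.3) p. 296 (`mid2 = 𝒬₄ + 𝒬₅ + 𝒬₆ + ½⟨Λ₈′φ^{(k)}, (Δ_{k,loc}(ũ) + aL⁻²P(ũ))Λ₈′φ^{(k)}⟩ + ½⟨Λ₈′ψ, Δ^L_{k+1,loc}Λ₈′ψ⟩ + ⟨φ^{(k)}, w₆ψ⟩ +
½⟨ψ, w₇ψ⟩`): the three displayed identities give hypothesis `hS` of `h59_of_sectors`. [cite: BalabanImbrieJaffe1988, (5.8.3) p.296] -/
theorem hS_of_steps (D : Bracket596 P k ι) (T : ι → Term41 P k) (a : ℝ)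
    (Qφ : ι → Prev P k → GaugeField P k U1 → HiggsField P k → HiggsField P (k+1))
    (Λ : ι → Finset (PBond P (k+1))) (s : ι → GaugeField P (k+1) U1 → GaugeField P k U1)
    (lamφ : ι → Prev P k → GaugeField P k U1 → GaugeField P (k+1) U1 → GaugeTransf P k U1)
    (lamψ : ι → Prev P k → GaugeField P k U1 → GaugeField P (k+1) U1 → GaugeTransf P (k+1) U1)
    (c : ι → Prev P k → GaugeField P k U1 → GaugeField P (k+1) U1 → HiggsField P (k+1) → HiggsField P k)
    (mid1 mid2 : Entry P k ι ℝ)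
    (h546 : ∀ t ∈ terms, ∀ prev u' v φ ψ, DeltaAx u' →
      gaussQuad a (Qφ t prev (uOrig Λ s t u' v) (phiOrig Λ s lamφ c t prev u' v φ ψ)) (psiOrig Λ s lamψ t prev u' v ψ)
        + (1 / 2 : ℝ) * scalarForm (T t) ((T t).uk prev (cfg (uOrig Λ s t u' v))) (phiOrig Λ s lamφ c t prev u' v φ ψ)
        + (T t).Ploc prev (cfg (uOrig Λ s t u' v)) (phiOrig Λ s lamφ c t prev u' v φ ψ) = mid1 t prev u' v φ ψ)
    (h5613 : ∀ t ∈ terms, ∀ prev u' v φ ψ, DeltaAx u' → mid1 t prev u' v φ ψ =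
      mid2 t prev u' v φ ψ + D.Pkloc t prev u' v φ ψ + D.Rk t prev u' v φ ψ + D.W1 t prev u' v φ ψ)
    (h583 : ∀ t ∈ terms, ∀ prev u' v φ ψ, DeltaAx u' → mid2 t prev u' v φ ψ =
      D.Q4 t prev u' v φ ψ + D.Q5 t prev u' v φ ψ + D.Q6 t prev u' v φ ψ + D.quadPhi t prev u' v φ ψ / 2
        + D.quadPsi t prev u' v φ ψ / 2 + D.phiW6Psi t prev u' v φ ψ + D.psiW7Psi t prev u' v φ ψ / 2) :
    ∀ t ∈ terms, ∀ prev u' v φ ψ, DeltaAx u' →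
      gaussQuad a (Qφ t prev (uOrig Λ s t u' v) (phiOrig Λ s lamφ c t prev u' v φ ψ)) (psiOrig Λ s lamψ t prev u' v ψ)
        + (1 / 2 : ℝ) * scalarForm (T t) ((T t).uk prev (cfg (uOrig Λ s t u' v))) (phiOrig Λ s lamφ c t prev u' v φ ψ)
        + (T t).Ploc prev (cfg (uOrig Λ s t u' v)) (phiOrig Λ s lamφ c t prev u' v φ ψ) =
        D.Q4 t prev u' v φ ψ + D.Q5 t prev u' v φ ψ + D.Q6 t prev u' v φ ψ + D.quadPhi t prev u' v φ ψ / 2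
          + D.quadPsi t prev u' v φ ψ / 2 + D.phiW6Psi t prev u' v φ ψ + D.psiW7Psi t prev u' v φ ψ / 2
          + D.Pkloc t prev u' v φ ψ + D.Rk t prev u' v φ ψ + D.W1 t prev u' v φ ψ := by
  intro t ht prev u' v φ ψ hax
  rw [h546 t ht prev u' v φ ψ hax, h5613 t ht prev u' v φ ψ hax, h583 t ht prev u' v φ ψ hax]

/-- **(Z) in its two printed steps** — p. 283: *"We can gauge away the term ∂C_kΛ₃^{(k)*}A′, leaving us with the following background gauge
field for the normalization factors (5.4.10)"* (the Gaussian normalization factors are gauge invariant: `Π_j[Z^{(j)}Z^{(j)}(u_k)]` equals the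
same product at the transformed background — entry `Zmid`), then (5.7.13) p. 295 (`Zmid = Π_j[Z^{(j)}Z^{(j)}(u_{k+1})] exp[−Q^{(k)} − Σ_XW₂^{(k)}(X)]`):
the two displayed identities give hypothesis `hZ` of `h59_of_sectors`. [cite: BalabanImbrieJaffe1988, (5.7.13) p.295] -/
theorem hZ_of_steps (D : Bracket596 P k ι) (T : ι → Term41 P k)
    (Λ : ι → Finset (PBond P (k+1))) (s : ι → GaugeField P (k+1) U1 → GaugeField P k U1) (Zmid : Entry P k ι ℝ)
    (hgauge : ∀ t ∈ terms, ∀ prev u' v φ ψ, DeltaAx u' →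
      (∏ j, (T t).Zv j * (T t).Zs j ((T t).uk prev (cfg (uOrig Λ s t u' v)))) = Zmid t prev u' v φ ψ)
    (h5713 : ∀ t ∈ terms, ∀ prev u' v φ ψ, DeltaAx u' →
      Zmid t prev u' v φ ψ = D.zf t prev u' v φ ψ * Real.exp (-(D.Qk t prev u' v φ ψ + D.W2 t prev u' v φ ψ))) :
    ∀ t ∈ terms, ∀ prev u' v φ ψ, DeltaAx u' →
      (∏ j, (T t).Zv j * (T t).Zs j ((T t).uk prev (cfg (uOrig Λ s t u' v)))) =
        D.zf t prev u' v φ ψ * Real.exp (-(D.Qk t prev u' v φ ψ + D.W2 t prev u' v φ ψ)) := by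
  intro t ht prev u' v φ ψ hax
  rw [hgauge t ht prev u' v φ ψ hax, h5713 t ht prev u' v φ ψ hax]

end Sectors

/-! ## §4 (5.9.6) at measure level from the sector identities -/

section Assembly

variable {ι : Type*} {terms : Finset ι} {ρL : GaugeField P (k+1) U1 → HiggsField P (k+1) → ℂ}

/-- **(5.9.6) AT MEASURE LEVEL FROM (5.2.8) AND THE SECTOR IDENTITIES.**  `eq596_printed_ax` for the (5.2.8) bracket of record `rho528 w T` with
`h59` supplied by `h59_of_sectors`: from the display (5.2.8) (`h528`, gen 8's `density528`) with integrable brackets, the measurability of the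
p. 282 phases, the p. 284 δ-claims for the (5.5.2) shifts, the (5.8.1) shifts, and the displayed identities (C) `hchars`/`hins`, `hholes`,
`hobs`, (Z) `hZ`, (G) `hG`, (S) `hS`, `hcalE`, `hEk`: the renamed density `ρ^L_{k+1}` satisfies line 1 of (5.9.6) with lines 2–8 as the bracket
and `∫dvdψ ρ^L_{k+1} = ∫dvdψ ρ̃^L_{k+1}` (standing range). [cite: BalabanImbrieJaffe1988, (5.9.6) p.297] -/
theorem eq596_of_sectors (D : Bracket596 P k ι) (T : ι → Term41 P k)
    (w : ι → Prev P k → GaugeField P k U1 → HiggsField P k → HiggsField P (k+1) → ℝ) (a : ℝ)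
    (Qφ : ι → Prev P k → GaugeField P k U1 → HiggsField P k → HiggsField P (k+1))
    (hk : k + 1 ≤ P.m + P.K) (h528 : IsRD (axialMeasure P k U1) terms qU Qφ a (rho528 w T) ρL)
    (hρi : ∀ t ∈ terms, Integrable
      (fun q : Fields P k => rho528 w T t q.2.1 q.1 q.2.2.1 q.2.2.2 * (gaussWeight a (Qφ t q.2.1 q.1 q.2.2.1) q.2.2.2 : ℂ))
      (fieldsMeasure (axialMeasure P k U1)))
    (Λ : ι → Finset (PBond P (k+1)))
    (lamφ : ι → Prev P k → GaugeField P k U1 → GaugeField P (k+1) U1 → GaugeTransf P k U1)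
    (lamψ : ι → Prev P k → GaugeField P k U1 → GaugeField P (k+1) U1 → GaugeTransf P (k+1) U1)
    (hmφ : ∀ t ∈ terms, Measurable fun x : GaugeField P k U1 × Prev P k => lamφ t x.2 (uCut qU (Λ t) x.1) (qU x.1))
    (hmψ : ∀ t ∈ terms, Measurable fun x : GaugeField P k U1 × Prev P k => lamψ t x.2 (uCut qU (Λ t) x.1) (qU x.1))
    (s : ι → GaugeField P (k+1) U1 → GaugeField P k U1) (hs : ∀ t ∈ terms, ∀ w, ∀ b ∈ (axialBonds : Finset (PBond P k)), s t w b = 1)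
    (S : ι → Set (GaugeField P k U1))
    (hsupp : ∀ t ∈ terms, ∀ prev u' v φ ψ, renamedBracket Qφ a (rho528 w T) Λ lamφ lamψ t prev u' v φ ψ ≠ 0 → u' ∈ S t)
    (hQS : ∀ t ∈ terms, ∀ u' ∈ S t, ∀ w, qU (bondMul u' (s t w)) = qU u' ∧ qU (bondMul u' fun b => (s t w b)⁻¹) = qU u')
    (c : ι → Prev P k → GaugeField P k U1 → GaugeField P (k+1) U1 → HiggsField P (k+1) → HiggsField P k)
    (χins : Entry P k ι ℝ)
    (hchars : ∀ t ∈ terms, ∀ prev u' v φ ψ, DeltaAx u' → D.chars t prev u' v φ ψ =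
      w t prev (uOrig Λ s t u' v) (phiOrig Λ s lamφ c t prev u' v φ ψ) (psiOrig Λ s lamψ t prev u' v ψ) *
        (T t).chi prev (cfg (uOrig Λ s t u' v)) (phiOrig Λ s lamφ c t prev u' v φ ψ) * χins t prev u' v φ ψ)
    (hins : ∀ t ∈ terms, ∀ prev u' v φ ψ, DeltaAx u' →
      w t prev (uOrig Λ s t u' v) (phiOrig Λ s lamφ c t prev u' v φ ψ) (psiOrig Λ s lamψ t prev u' v ψ) *
        (T t).chi prev (cfg (uOrig Λ s t u' v)) (phiOrig Λ s lamφ c t prev u' v φ ψ) ≠ 0 → χins t prev u' v φ ψ = 1)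
    (hholes : ∀ t ∈ terms, ∀ prev u' v φ ψ, DeltaAx u' → D.holes t prev u' v φ ψ =
      ((∏ ω, (T t).g ω prev (cfg (uOrig Λ s t u' v)) (phiOrig Λ s lamφ c t prev u' v φ ψ) : ℝ) : ℂ))
    (hobs : ∀ t ∈ terms, ∀ prev u' v φ ψ, DeltaAx u' → D.obs t prev u' v φ ψ =
      ∏ σ, (T t).Floc σ prev (cfg (uOrig Λ s t u' v)) (phiOrig Λ s lamφ c t prev u' v φ ψ))
    (hZ : ∀ t ∈ terms, ∀ prev u' v φ ψ, DeltaAx u' →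
      (∏ j, (T t).Zv j * (T t).Zs j ((T t).uk prev (cfg (uOrig Λ s t u' v)))) =
        D.zf t prev u' v φ ψ * Real.exp (-(D.Qk t prev u' v φ ψ + D.W2 t prev u' v φ ψ)))
    (hG : ∀ t ∈ terms, ∀ prev u' v φ ψ, DeltaAx u' →
      (1 / 2 : ℝ) * gaugeForm (T t) (cfg (uOrig Λ s t u' v)) =
        D.Q1 t prev u' v φ ψ + D.quadA t prev u' v φ ψ / 2 + D.quadF t prev u' v φ ψ / 2 + D.Q2 t prev u' v φ ψ + D.Q3 t prev u' v φ ψ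
          + D.fw3A t prev u' v φ ψ + D.fw4f t prev u' v φ ψ / 2)
    (hS : ∀ t ∈ terms, ∀ prev u' v φ ψ, DeltaAx u' →
      gaussQuad a (Qφ t prev (uOrig Λ s t u' v) (phiOrig Λ s lamφ c t prev u' v φ ψ)) (psiOrig Λ s lamψ t prev u' v ψ)
        + (1 / 2 : ℝ) * scalarForm (T t) ((T t).uk prev (cfg (uOrig Λ s t u' v))) (phiOrig Λ s lamφ c t prev u' v φ ψ)
        + (T t).Ploc prev (cfg (uOrig Λ s t u' v)) (phiOrig Λ s lamφ c t prev u' v φ ψ) =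
        D.Q4 t prev u' v φ ψ + D.Q5 t prev u' v φ ψ + D.Q6 t prev u' v φ ψ + D.quadPhi t prev u' v φ ψ / 2
          + D.quadPsi t prev u' v φ ψ / 2 + D.phiW6Psi t prev u' v φ ψ + D.psiW7Psi t prev u' v φ ψ / 2
          + D.Pkloc t prev u' v φ ψ + D.Rk t prev u' v φ ψ + D.W1 t prev u' v φ ψ)
    (hcalE : ∀ t ∈ terms, ∀ prev u' v φ ψ, D.calE t prev u' v φ ψ = (T t).calE)
    (hEk : ∀ t ∈ terms, ∀ prev u' v φ ψ, D.Ek t prev u' v φ ψ = E0step (Fintype.card (Balaban1983to89.Site P (k+1))) a P.L P.d) :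
    IsDT (axialMeasure P k U1) terms Λ qU (bracket596 D) (rho596 terms Λ (renamedBracket Qφ a (rho528 w T) Λ lamφ lamψ)) ∧
      ∫ v, ∫ ψ, rho596 terms Λ (renamedBracket Qφ a (rho528 w T) Λ lamφ lamψ) v ψ ∂volume ∂fieldMeasure P (k+1) U1 =
        ∫ v, ∫ ψ, ρL v ψ ∂volume ∂fieldMeasure P (k+1) U1 :=
  eq596_printed_ax D hk h528 hρi Λ lamφ lamψ hmφ hmψ s hs S hsupp hQS c
    (h59_of_sectors D T w a Qφ Λ s lamφ lamψ c χins hchars hins hholes hobs hZ hG hS hcalE hEk)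

/-- **The (5.9.6) table with the entries that are "the same objects" FILLED from the (4.1) data**: `chars := ζχ·χ_k·χ_ins` (Sect. 5.9),
`holes := Π_ωg_k(X_ω)`, `obs := Π_σF_{k,loc}(X_σ)` (= `Π_σ(F^{(m̄)} + F̃)`, (5.6.14)), `calE := ℰ_k`, `Ek := E^{(k)}` (r18's `E0step` on the
`L`-lattice), all read at the original variables `(uOrig, phiOrig, psiOrig)`; the 21 − 2 remaining entries of the exponent and `zf` are
those of `D`. [cite: BalabanImbrieJaffe1988, (5.9.6) p.297] -/
def fill41 (D : Bracket596 P k ι) (T : ι → Term41 P k)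
    (w : ι → Prev P k → GaugeField P k U1 → HiggsField P k → HiggsField P (k+1) → ℝ) (a : ℝ)
    (Λ : ι → Finset (PBond P (k+1))) (s : ι → GaugeField P (k+1) U1 → GaugeField P k U1)
    (lamφ : ι → Prev P k → GaugeField P k U1 → GaugeField P (k+1) U1 → GaugeTransf P k U1)
    (lamψ : ι → Prev P k → GaugeField P k U1 → GaugeField P (k+1) U1 → GaugeTransf P (k+1) U1)
    (c : ι → Prev P k → GaugeField P k U1 → GaugeField P (k+1) U1 → HiggsField P (k+1) → HiggsField P k)
    (χins : Entry P k ι ℝ) : Bracket596 P k ι :=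
  { D with
    chars := fun t prev u' v φ ψ =>
      w t prev (uOrig Λ s t u' v) (phiOrig Λ s lamφ c t prev u' v φ ψ) (psiOrig Λ s lamψ t prev u' v ψ) *
        (T t).chi prev (cfg (uOrig Λ s t u' v)) (phiOrig Λ s lamφ c t prev u' v φ ψ) * χins t prev u' v φ ψ
    holes := fun t prev u' v φ ψ => ((∏ ω, (T t).g ω prev (cfg (uOrig Λ s t u' v)) (phiOrig Λ s lamφ c t prev u' v φ ψ) : ℝ) : ℂ)
    obs := fun t prev u' v φ ψ => ∏ σ, (T t).Floc σ prev (cfg (uOrig Λ s t u' v)) (phiOrig Λ s lamφ c t prev u' v φ ψ)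
    calE := fun t _ _ _ _ _ => (T t).calE
    Ek := fun _ _ _ _ _ _ => E0step (Fintype.card (Balaban1983to89.Site P (k+1))) a P.L P.d }

/-- **(5.9.6) AT MEASURE LEVEL — WHAT IS LEFT OF `h59` IS EXACTLY THE FOUR PRINTED SECTOR IDENTITIES.**  `eq596_of_sectors` for the filled
table `fill41 D …`: besides the display (5.2.8) with integrable brackets, the measurability of the p. 282 phases, the p. 284 δ-claims and the
(5.8.1) shifts (all as in `BIJ88Eq596Density.eq596_printed`), the hypotheses are (C) `hins` — the Sect. 5.9 insertions equal `1` on the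
support of `ζχ·χ_k` ((5.9.1)–(5.9.5), p. 297 *"without changing anything"*), (Z) `hZ` — (5.7.13) with the gauge invariance of the
normalization factors, (G) `hG` — (5.3.5)+(5.5.12), (S) `hS` — (5.4.6)+(5.6.13)+(5.8.3).  Conclusion: the renamed density satisfies line 1 of
(5.9.6) with the bracket `bracket596 (fill41 D …)` = `ζχχ_kχ_ins · Πg_k · ΠF_{k,loc} · Π[ZZ(u_{k+1})] · exp[lines 3–8]`, and has the total integral
of `ρ̃^L_{k+1}`. [cite: BalabanImbrieJaffe1988, (5.9.6) p.297] -/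
theorem eq596_of_sectors_filled (D : Bracket596 P k ι) (T : ι → Term41 P k)
    (w : ι → Prev P k → GaugeField P k U1 → HiggsField P k → HiggsField P (k+1) → ℝ) (a : ℝ)
    (Qφ : ι → Prev P k → GaugeField P k U1 → HiggsField P k → HiggsField P (k+1))
    (hk : k + 1 ≤ P.m + P.K) (h528 : IsRD (axialMeasure P k U1) terms qU Qφ a (rho528 w T) ρL)
    (hρi : ∀ t ∈ terms, Integrable
      (fun q : Fields P k => rho528 w T t q.2.1 q.1 q.2.2.1 q.2.2.2 * (gaussWeight a (Qφ t q.2.1 q.1 q.2.2.1) q.2.2.2 : ℂ))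
      (fieldsMeasure (axialMeasure P k U1)))
    (Λ : ι → Finset (PBond P (k+1)))
    (lamφ : ι → Prev P k → GaugeField P k U1 → GaugeField P (k+1) U1 → GaugeTransf P k U1)
    (lamψ : ι → Prev P k → GaugeField P k U1 → GaugeField P (k+1) U1 → GaugeTransf P (k+1) U1)
    (hmφ : ∀ t ∈ terms, Measurable fun x : GaugeField P k U1 × Prev P k => lamφ t x.2 (uCut qU (Λ t) x.1) (qU x.1))
    (hmψ : ∀ t ∈ terms, Measurable fun x : GaugeField P k U1 × Prev P k => lamψ t x.2 (uCut qU (Λ t) x.1) (qU x.1))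
    (s : ι → GaugeField P (k+1) U1 → GaugeField P k U1) (hs : ∀ t ∈ terms, ∀ w, ∀ b ∈ (axialBonds : Finset (PBond P k)), s t w b = 1)
    (S : ι → Set (GaugeField P k U1))
    (hsupp : ∀ t ∈ terms, ∀ prev u' v φ ψ, renamedBracket Qφ a (rho528 w T) Λ lamφ lamψ t prev u' v φ ψ ≠ 0 → u' ∈ S t)
    (hQS : ∀ t ∈ terms, ∀ u' ∈ S t, ∀ w, qU (bondMul u' (s t w)) = qU u' ∧ qU (bondMul u' fun b => (s t w b)⁻¹) = qU u')
    (c : ι → Prev P k → GaugeField P k U1 → GaugeField P (k+1) U1 → HiggsField P (k+1) → HiggsField P k)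
    (χins : Entry P k ι ℝ)
    (hins : ∀ t ∈ terms, ∀ prev u' v φ ψ, DeltaAx u' →
      w t prev (uOrig Λ s t u' v) (phiOrig Λ s lamφ c t prev u' v φ ψ) (psiOrig Λ s lamψ t prev u' v ψ) *
        (T t).chi prev (cfg (uOrig Λ s t u' v)) (phiOrig Λ s lamφ c t prev u' v φ ψ) ≠ 0 → χins t prev u' v φ ψ = 1)
    (hZ : ∀ t ∈ terms, ∀ prev u' v φ ψ, DeltaAx u' →
      (∏ j, (T t).Zv j * (T t).Zs j ((T t).uk prev (cfg (uOrig Λ s t u' v)))) =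
        D.zf t prev u' v φ ψ * Real.exp (-(D.Qk t prev u' v φ ψ + D.W2 t prev u' v φ ψ)))
    (hG : ∀ t ∈ terms, ∀ prev u' v φ ψ, DeltaAx u' →
      (1 / 2 : ℝ) * gaugeForm (T t) (cfg (uOrig Λ s t u' v)) =
        D.Q1 t prev u' v φ ψ + D.quadA t prev u' v φ ψ / 2 + D.quadF t prev u' v φ ψ / 2 + D.Q2 t prev u' v φ ψ + D.Q3 t prev u' v φ ψ
          + D.fw3A t prev u' v φ ψ + D.fw4f t prev u' v φ ψ / 2)
    (hS : ∀ t ∈ terms, ∀ prev u' v φ ψ, DeltaAx u' →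
      gaussQuad a (Qφ t prev (uOrig Λ s t u' v) (phiOrig Λ s lamφ c t prev u' v φ ψ)) (psiOrig Λ s lamψ t prev u' v ψ)
        + (1 / 2 : ℝ) * scalarForm (T t) ((T t).uk prev (cfg (uOrig Λ s t u' v))) (phiOrig Λ s lamφ c t prev u' v φ ψ)
        + (T t).Ploc prev (cfg (uOrig Λ s t u' v)) (phiOrig Λ s lamφ c t prev u' v φ ψ) =
        D.Q4 t prev u' v φ ψ + D.Q5 t prev u' v φ ψ + D.Q6 t prev u' v φ ψ + D.quadPhi t prev u' v φ ψ / 2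
          + D.quadPsi t prev u' v φ ψ / 2 + D.phiW6Psi t prev u' v φ ψ + D.psiW7Psi t prev u' v φ ψ / 2
          + D.Pkloc t prev u' v φ ψ + D.Rk t prev u' v φ ψ + D.W1 t prev u' v φ ψ) :
    IsDT (axialMeasure P k U1) terms Λ qU (bracket596 (fill41 D T w a Λ s lamφ lamψ c χins))
        (rho596 terms Λ (renamedBracket Qφ a (rho528 w T) Λ lamφ lamψ)) ∧
      ∫ v, ∫ ψ, rho596 terms Λ (renamedBracket Qφ a (rho528 w T) Λ lamφ lamψ) v ψ ∂volume ∂fieldMeasure P (k+1) U1 =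
        ∫ v, ∫ ψ, ρL v ψ ∂volume ∂fieldMeasure P (k+1) U1 :=
  eq596_of_sectors (fill41 D T w a Λ s lamφ lamψ c χins) T w a Qφ hk h528 hρi Λ lamφ lamψ hmφ hmψ s hs S hsupp hQS c χins
    (fun _ _ _ _ _ _ _ _ => rfl) hins (fun _ _ _ _ _ _ _ _ => rfl) (fun _ _ _ _ _ _ _ _ => rfl) hZ hG hS (fun _ _ _ _ _ _ _ => rfl)
    (fun _ _ _ _ _ _ _ => rfl)

end Assembly

/-! ## §5 The input (5.2.8) for the bracket of record, by name -/

section Input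

open BIJ88Eq528Density (Point Coeff522 chi522 weight527 density528 density528_rt51_printed)
open BIJ88RT51GeneralStep (IsRT511Ax)
open BIJ88RT51Exists (rt51)

variable {ι ιp : Type*} [DecidableEq ιp] {terms : Finset ι} {Qu : GaugeField P k U1 → GaugeField P (k+1) U1}
variable {Qφ : ι → Prev P k → GaugeField P k U1 → HiggsField P k → HiggsField P (k+1)} {a : ℝ} {T : ι → Term41 P k}
variable {ρL : GaugeField P (k+1) U1 → HiggsField P (k+1) → ℂ}

/-- **The hypothesis `h528` of `eq596_of_sectors` IS gen 8's (5.2.8)** (`BIJ88Eq528Density.density528`, definitionally): for the terms of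
(4.1) (`ρ′_t = rhoPrime (T t) ∘ cfg`) satisfying (5.1.1)+(5.1.4), the display (5.2.8) holds for the bracket of record `rho528 w T` with the
weight `w` = the printed `ζ_{Λ₀^{(k)c}}χ_{Λ₀^{(k)}}` of (5.2.7) at the printed `χ_x, χ_y, χ_b, χ_p` (5.2.2), over the terms `({X_ω}, Λ₀^{(k)})`.
[cite: BalabanImbrieJaffe1988, (5.2.8) p.279] -/
theorem isRD_rho528 (ha : 0 < a) (hd : 2 ≤ P.d)
    (h : IsRT511Ax terms Qu Qφ a (fun t prev U φ => rhoPrime (T t) prev (cfg U) φ) ρL) (hQu : Measurable Qu)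
    (hQφ : ∀ t ∈ terms, Measurable fun p : Prev P k × (GaugeField P k U1 × HiggsField P k) => Qφ t p.1 p.2.1 p.2.2)
    (hρm : ∀ t ∈ terms, Measurable fun p : Prev P k × (GaugeField P k U1 × HiggsField P k) => rhoPrime (T t) p.1 (cfg p.2.1) p.2.2)
    (hρi : ∀ t ∈ terms, Integrable (fun q : GaugeField P k U1 × (Prev P k × HiggsField P k) => rhoPrime (T t) q.2.1 (cfg q.1) q.2.2)
      ((axialMeasure P k U1).prod ((prevMeasure P k).prod volume)))
    (χ : BIJ88Sect5Statements.CutoffProfile) (c : Coeff522) (ubar : ι → Prev P k → GaugeField P k U1 → (PBond P k → ℂ))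
    (hubar : ∀ t ∈ terms, Measurable fun p : Prev P k × GaugeField P k U1 => ubar t p.1 p.2)
    (S : ι → Finset ιp) (pt : ι → ιp → Point P k) (Rmap : ι → Finset ιp → Finset ιp)
    (hR : ∀ t ∈ terms, ∀ T' ∈ (S t).powerset, Rmap t T' ⊆ S t \ T') :
    IsRD (axialMeasure P k U1) (terms.sigma fun t => (S t).powerset.image (Rmap t)) Qu (fun tr => Qφ tr.1) a
      (rho528 (fun tr => weight527 (S tr.1) (Rmap tr.1) (fun i => chi522 χ c (Qφ tr.1) (ubar tr.1) (pt tr.1 i)) tr.2)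
        (fun tr => T tr.1)) ρL :=
  density528 ha hd h hQu hQφ hρm hρi χ c ubar hubar S pt Rmap hR

/-- **… and holds with NO hypothesis on the density for gen 6's constructed `ρ̃^L_{k+1} = rt51 (𝒟u δ_{Ax}) …`** of (5.1.1)+(5.1.4) and the printed
gauge-field block average `Q` (`BIJ88Eq528Density.density528_rt51_printed`; standing range). [cite: BalabanImbrieJaffe1988, (5.2.8) p.279] -/
theorem isRD_rho528_rt51 (hk : k + 1 ≤ P.m + P.K) (ha : 0 < a) (hd : 2 ≤ P.d)
    (hQφ : ∀ t ∈ terms, Measurable fun p : Prev P k × (GaugeField P k U1 × HiggsField P k) => Qφ t p.1 p.2.1 p.2.2)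
    (hρm : ∀ t ∈ terms, Measurable fun p : Prev P k × (GaugeField P k U1 × HiggsField P k) => rhoPrime (T t) p.1 (cfg p.2.1) p.2.2)
    (hρi : ∀ t ∈ terms, Integrable (fun q : GaugeField P k U1 × (Prev P k × HiggsField P k) => rhoPrime (T t) q.2.1 (cfg q.1) q.2.2)
      ((axialMeasure P k U1).prod ((prevMeasure P k).prod volume)))
    (χ : BIJ88Sect5Statements.CutoffProfile) (c : Coeff522) (ubar : ι → Prev P k → GaugeField P k U1 → (PBond P k → ℂ))
    (hubar : ∀ t ∈ terms, Measurable fun p : Prev P k × GaugeField P k U1 => ubar t p.1 p.2)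
    (S : ι → Finset ιp) (pt : ι → ιp → Point P k) (Rmap : ι → Finset ιp → Finset ιp)
    (hR : ∀ t ∈ terms, ∀ T' ∈ (S t).powerset, Rmap t T' ⊆ S t \ T') :
    IsRD (axialMeasure P k U1) (terms.sigma fun t => (S t).powerset.image (Rmap t)) qU (fun tr => Qφ tr.1) a
      (rho528 (fun tr => weight527 (S tr.1) (Rmap tr.1) (fun i => chi522 χ c (Qφ tr.1) (ubar tr.1) (pt tr.1 i)) tr.2)
        (fun tr => T tr.1))
      (rt51 (axialMeasure P k U1) terms qU Qφ a fun t prev U φ => rhoPrime (T t) prev (cfg U) φ) :=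
  density528_rt51_printed hk ha hd hQφ hρm hρi χ c ubar hubar S pt Rmap hR

end Input

end

end Literature.MathematicalPhysics.QuantumFieldTheory.BalabanImbrieJaffe1984to88.BIJ88Eq596Sectors
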